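import Mathlib
import Literature.Computability.AlgebraicComplexity.NestFreeMatchingFifo
import Summits.ValiantsHypothesis.ValiantsHypothesis.Theorems.FifoMatchingNNMonotoneHardPadBoundaries
import HarnessLib

/-!
# Route FifoMatching — crux `NNDivisionHard` (stmt-ValiantsHypothesis-21181): the arcs of the padded thick queue are LONG

The thick-queue measure of `NNMonotoneHard.exists_thick_measure` (the measure behind `NNMonotoneExpBound.exp_lower_bound`
and every union-bound rung of record) is the law of the FIFO pairing of the padded word `W = U^L v D^L`
(`NNMonotoneHard.padWord L N v`) for a balanced middle word `v` whose prefix sums stay in `(-m, m)` (`1 ≤ m ≤ L`).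
This file proves the one combinatorial fact about that pairing which the residual programme of stmt-21181 asked for
(`FifoMatchingNNDivisionHardShortLocalConditional.lean`, «WHAT IS MISSING»; `…LocalCofactor.lean`, «READING»):

* `card_lt_true_add_card_lt_false`, `card_lt_true_le_add`, `two_mul_card_false` — prefix-count bookkeeping for `v`;
* ★ `card_closers_lt_lt_card_openers_lt_delay` — **the DELAYED queue inequality**: at every closer time `t` of `W`,
  `#closers<t < #openers<(t − (L − m))` — the arc closed at time `t` was opened more than `L − m` steps earlier, because the
  queue always holds at least `L − m + 1` arcs (the `L` padding openers minus the deficit `< m` of `v`), and at most one arc is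
  opened per step;
* ★★ `opener_add_le_closer` — **every FIFO arc of `U^L v D^L` has length `≥ L − m + 1`**: `o_k + (L − m + 1) ≤ c_k` for the
  `k`-th opener `o_k` and the `k`-th closer `c_k`;
* ★★ `fifo_padWord_arcs_long`, `cast_fifo_padWord_arcs_long` — the same for the matching `fifo W` (and for its transport to
  `Fin (2n)` along `Fin.cast`, the form in which the thick-queue measure is stated): `i + (L − m + 1) ≤ M i` for every opener `i`.

With the parameters of `NNMonotoneExpBound` (`m = u³`, `L = 8u⁴ + 3u³`, `n < 13600 u⁵ ≤ u⁶`) the bound is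
`L − m + 1 = 8u⁴ + 2u³ + 1 > n^{2/3}`.  The export to the measure (support clause) and the unconditional form of
`ShortLocalConditional.shortLocal_lower_bound_of_longSpreadMeasure` are the sequel files
`FifoMatchingNNDivisionHardThickMeasureSupport.lean` / `FifoMatchingNNDivisionHardShortLocal.lean`.
HONEST FRAMING: word combinatorics for ONE measure; stmt-21181 stays OPEN; nothing here bears on `NNNotVP` or on VP ≠ VNP
(NOT proved).  No definitions, no named facts.
References: Grytczuk–Pawlik–Ruciński 2025 Prop. 1 (FIFO pairing) [GrytczukPawlikRucinski2025]; Hrubeš–Yehudayoff 2021 §6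
[HrubesYehudayoff2021].
-/

noncomputable section

-- Sub = Summit single-conjunct layout: the duplicated namespace component is mandated by the tree.
set_option linter.dupNamespace false
set_option autoImplicit false

namespace Summit.ValiantsHypothesis.ValiantsHypothesis.Theorems.FifoMatching.NNDivisionHard.PadWordLongArcs

open Finset Literature.Computability.AlgebraicComplexity
open Summit.ValiantsHypothesis.ValiantsHypothesis.Theorems.FifoMatching.NNMonotoneHard

/-! ### §1 Prefix counts of the middle word -/

section Counts

variable {N : ℕ} (v : Fin N → Bool)

/-- The number of positions of `Fin N` below `j ≤ N` is `j`. [folklore] -/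
theorem card_filter_val_lt {j : ℕ} (hj : j ≤ N) :
    ((univ : Finset (Fin N)).filter fun p => p.val < j).card = j := by
  rw [← Finset.card_map Fin.valEmbedding]
  have : ((univ : Finset (Fin N)).filter fun p => p.val < j).map Fin.valEmbedding = Finset.range j := by
    ext t
    simp only [mem_map, mem_filter, mem_univ, true_and, Fin.valEmbedding_apply, mem_range]
    exact ⟨fun ⟨i, hi, hit⟩ => hit ▸ hi, fun ht => ⟨⟨t, lt_of_lt_of_le ht hj⟩, ht, rfl⟩⟩
  rw [this, card_range]

/-- **Prefix letter counts add up**: `#{p < j : v p = U} + #{p < j : v p = D} = j` for `j ≤ N`. [folklore] -/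
theorem card_lt_true_add_card_lt_false {j : ℕ} (hj : j ≤ N) :
    ((univ : Finset (Fin N)).filter fun p => p.val < j ∧ v p = true).card
      + ((univ : Finset (Fin N)).filter fun p => p.val < j ∧ v p = false).card = j := by
  classical
  have h := card_filter_add_card_filter_not (s := (univ : Finset (Fin N)).filter fun p => p.val < j)
    (fun p => v p = true)
  rw [filter_filter, filter_filter, card_filter_val_lt hj] at h
  have e : ((univ : Finset (Fin N)).filter fun p => p.val < j ∧ ¬ v p = true)
      = ((univ : Finset (Fin N)).filter fun p => p.val < j ∧ v p = false) :=
    filter_congr fun p _ => by rw [Bool.not_eq_true]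
  rw [e] at h
  convert h using 2

/-- Prefix letter counts are monotone in the prefix length. [folklore] -/
theorem card_lt_mono (b : Bool) {j j' : ℕ} (hjj : j' ≤ j) :
    ((univ : Finset (Fin N)).filter fun p => p.val < j' ∧ v p = b).card
      ≤ ((univ : Finset (Fin N)).filter fun p => p.val < j ∧ v p = b).card :=
  card_le_card fun p hp => by
    rw [mem_filter] at hp ⊢
    exact ⟨hp.1, lt_of_lt_of_le hp.2.1 hjj, hp.2.2⟩

/-- **At most one opener per step**: `#{p < j : v p = U} ≤ #{p < j' : v p = U} + (j − j')` for `j' ≤ j ≤ N`. [folklore] -/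
theorem card_lt_true_le_add {j j' : ℕ} (hjj : j' ≤ j) (hj : j ≤ N) :
    ((univ : Finset (Fin N)).filter fun p => p.val < j ∧ v p = true).card
      ≤ ((univ : Finset (Fin N)).filter fun p => p.val < j' ∧ v p = true).card + (j - j') := by
  have h1 := card_lt_true_add_card_lt_false v hj
  have h2 := card_lt_true_add_card_lt_false v (hjj.trans hj)
  have h3 := card_lt_mono v false hjj
  omega

/-- A balanced word has as many `D`s as `U`s: `2 · #v⁻¹(D) = N`. [folklore] -/
theorem two_mul_card_false (hbal : 2 * ((univ : Finset (Fin N)).filter fun p => v p = true).card = N) :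
    2 * ((univ : Finset (Fin N)).filter fun p => v p = false).card = N := by
  have := card_true_add_card_false v
  omega

end Counts

/-! ### §2 The delayed queue inequality for `U^L v D^L` -/

section Pad

variable {L N m : ℕ} (v : Fin N → Bool)

/-- ★ **The DELAYED queue inequality.**  Let `v` be balanced with prefix sums in `(-m, m)` (both sides), `1 ≤ m ≤ L`, and let
`t` be a CLOSER time of the padded word `W = U^L v D^L`.  Then `#closers<t < #openers<(t + m − L)`: the arc closed at time
`t` (the `#closers<t`-th) was opened before time `t − (L − m)`.  Proof by the three phases of the rank bookkeeping
(`ranks_padWord_head/mid/tail`): in the middle the deficit of `v` is `< m` and at most one opener appears per step; in the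
tail the surplus of `v` is `< m` and `v` is balanced. [folklore] -/
theorem card_closers_lt_lt_card_openers_lt_delay
    (hbal : 2 * ((univ : Finset (Fin N)).filter fun p => v p = true).card = N)
    (hband : ∀ j, j ≤ N →
      ((univ : Finset (Fin N)).filter fun p => p.val < j ∧ v p = false).card
        < ((univ : Finset (Fin N)).filter fun p => p.val < j ∧ v p = true).card + m ∧
      ((univ : Finset (Fin N)).filter fun p => p.val < j ∧ v p = true).card
        < ((univ : Finset (Fin N)).filter fun p => p.val < j ∧ v p = false).card + m)
    (hmL : m ≤ L) (hm : 1 ≤ m) {t : ℕ} (htM : t < L + N + L)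
    (ht : padWord L N v ⟨t, htM⟩ = false) :
    ((closerSet (padWord L N v)).filter fun i => i.val < t).card
      < ((openerSet (padWord L N v)).filter fun i => i.val < t + m - L).card := by
  -- the first `L` letters are openers, so `L ≤ t`
  have hLt : L ≤ t := by
    by_contra hlt
    rw [not_le] at hlt
    have h1 := padWord_apply_of_lt (L := L) (N := N) v (i := ⟨t, htM⟩) hlt
    rw [h1] at ht
    exact Bool.noConfusion ht
  have hD := two_mul_card_false v hbal
  rcases lt_or_ge t (L + N) with hmid | htail
  · -- middle phase: `t = L + j`, `j < N`, `v j = D`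
    obtain ⟨j, rfl⟩ : ∃ j, t = L + j := ⟨t - L, by omega⟩
    have hj : j < N := by omega
    obtain ⟨-, hC⟩ := ranks_padWord_mid (L := L) (N := N) v (j := j) hj.le
    rw [hC]
    have hsum := card_lt_true_add_card_lt_false v hj.le
    rcases le_or_gt (j + m) L with hjm | hjm
    · -- the delayed time is still in the head
      have e : L + j + m - L = j + m := by omega
      rw [e, (ranks_padWord_head (L := L) (N := N) v (t := j + m) hjm).1]
      omega
    · -- the delayed time is `L + j'`, `j' = j + m - L ≤ j`
      have e : L + j + m - L = L + (j + m - L) := by omega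
      have hj' : j + m - L ≤ N := by omega
      rw [e, (ranks_padWord_mid (L := L) (N := N) v (j := j + m - L) hj').1]
      have hb := (hband j hj.le).1
      have hstep := card_lt_true_le_add v (show j + m - L ≤ j by omega) hj.le
      omega
  · -- tail phase: `t = L + N + i`, `i < L`
    obtain ⟨i, rfl⟩ : ∃ i, t = L + N + i := ⟨t - L - N, by omega⟩
    have hi : i < L := by omega
    obtain ⟨-, hC⟩ := ranks_padWord_tail (L := L) (N := N) v (i := i) hi.le
    rw [hC]
    rcases le_or_gt (N + i + m) L with h1 | h1
    · -- delayed time in the head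
      have e : L + N + i + m - L = N + i + m := by omega
      rw [e, (ranks_padWord_head (L := L) (N := N) v (t := N + i + m) h1).1]
      omega
    rcases le_or_gt (N + i + m) (L + N) with h2 | h2
    · -- delayed time in the middle: `L + j'`, `j' = N + i + m - L ≤ N`
      have e : L + N + i + m - L = L + (N + i + m - L) := by omega
      have hj' : N + i + m - L ≤ N := by omega
      rw [e, (ranks_padWord_mid (L := L) (N := N) v (j := N + i + m - L) hj').1]
      have hb := (hband (N + i + m - L) hj').1
      have hsum := card_lt_true_add_card_lt_false v hj'
      omega
    · -- delayed time in the tail: `L + N + i'`, `i' = i + m - L ≤ L`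
      have e : L + N + i + m - L = L + N + (i + m - L) := by omega
      have hi' : i + m - L ≤ L := by omega
      rw [e, (ranks_padWord_tail (L := L) (N := N) v (i := i + m - L) hi').1]
      have := card_true_add_card_false v
      omega

/-- ★★ **Every FIFO arc of the padded thick word is long**: for `v` balanced with prefix sums in `(-m, m)`, `1 ≤ m ≤ L`,
the `k`-th opener `o_k` and the `k`-th closer `c_k` of `W = U^L v D^L` satisfy `o_k + (L − m + 1) ≤ c_k`.
[cite: GrytczukPawlikRucinski2025, Prop. 1] -/
theorem opener_add_le_closer
    (hbal : 2 * ((univ : Finset (Fin N)).filter fun p => v p = true).card = N)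
    (hband : ∀ j, j ≤ N →
      ((univ : Finset (Fin N)).filter fun p => p.val < j ∧ v p = false).card
        < ((univ : Finset (Fin N)).filter fun p => p.val < j ∧ v p = true).card + m ∧
      ((univ : Finset (Fin N)).filter fun p => p.val < j ∧ v p = true).card
        < ((univ : Finset (Fin N)).filter fun p => p.val < j ∧ v p = false).card + m)
    (hmL : m ≤ L) (hm : 1 ≤ m) (k : Fin (openerSet (padWord L N v)).card) :
    ((openerSet (padWord L N v)).orderEmbOfFin rfl k : ℕ) + (L - m + 1)
      ≤ ((closerSet (padWord L N v)).orderEmbOfFin (balanced_padWord v hbal) k : ℕ) := by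
  -- the `k`-th closer `c` is a closer, of closer-rank `k`, at a time `≥ L`
  have hWc : padWord L N v ((closerSet (padWord L N v)).orderEmbOfFin (balanced_padWord v hbal) k) = false :=
    apply_closer (balanced_padWord v hbal) k
  have hrk : ((closerSet (padWord L N v)).filter fun i =>
      i < (closerSet (padWord L N v)).orderEmbOfFin (balanced_padWord v hbal) k).card = k :=
    card_filter_lt_orderEmbOfFin (balanced_padWord v hbal) k
  rw [filter_lt_fin_eq] at hrk
  have hLc : L ≤ ((closerSet (padWord L N v)).orderEmbOfFin (balanced_padWord v hbal) k : ℕ) := by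
    by_contra hlt
    rw [not_le] at hlt
    have h1 := padWord_apply_of_lt (L := L) (N := N) v hlt
    rw [h1] at hWc
    exact Bool.noConfusion hWc
  -- the delayed inequality at time `c`
  have hdel := card_closers_lt_lt_card_openers_lt_delay v hbal hband hmL hm
    ((closerSet (padWord L N v)).orderEmbOfFin (balanced_padWord v hbal) k).isLt hWc
  rw [hrk] at hdel
  -- hence `o_k < c + m - L`
  have htM : ((closerSet (padWord L N v)).orderEmbOfFin (balanced_padWord v hbal) k : ℕ) + m - L
      < L + N + L := by
    have := ((closerSet (padWord L N v)).orderEmbOfFin (balanced_padWord v hbal) k).isLt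
    omega
  have hlt : (openerSet (padWord L N v)).orderEmbOfFin rfl k
      < (⟨((closerSet (padWord L N v)).orderEmbOfFin (balanced_padWord v hbal) k : ℕ) + m - L, htM⟩ :
        Fin (L + N + L)) := by
    rw [orderEmbOfFin_lt_iff, filter_lt_fin_eq]
    exact hdel
  rw [Fin.lt_def] at hlt
  change ((openerSet (padWord L N v)).orderEmbOfFin rfl k : ℕ)
    < ((closerSet (padWord L N v)).orderEmbOfFin (balanced_padWord v hbal) k : ℕ) + m - L at hlt
  omega

/-- ★★ **All arcs of `fifo (U^L v D^L)` have length `≥ L − m + 1`**: `i + (L − m + 1) ≤ fifo W h i` for every opener `i`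
of the padded word (`v` balanced, prefix sums in `(-m, m)`, `1 ≤ m ≤ L`). [cite: GrytczukPawlikRucinski2025, Prop. 1] -/
theorem fifo_padWord_arcs_long
    (hbal : 2 * ((univ : Finset (Fin N)).filter fun p => v p = true).card = N)
    (hband : ∀ j, j ≤ N →
      ((univ : Finset (Fin N)).filter fun p => p.val < j ∧ v p = false).card
        < ((univ : Finset (Fin N)).filter fun p => p.val < j ∧ v p = true).card + m ∧
      ((univ : Finset (Fin N)).filter fun p => p.val < j ∧ v p = true).card
        < ((univ : Finset (Fin N)).filter fun p => p.val < j ∧ v p = false).card + m)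
    (hmL : m ≤ L) (hm : 1 ≤ m) {i : Fin (L + N + L)} (hi : padWord L N v i = true) :
    (i : ℕ) + (L - m + 1) ≤ (fifo (padWord L N v) (balanced_padWord v hbal) i : ℕ) := by
  obtain ⟨k, rfl⟩ := exists_eq_opener hi
  rw [fifo_opener]
  exact opener_add_le_closer v hbal hband hmL hm k

/-- The openers of `fifo (U^L v D^L)` are the `U`-positions of the padded word. [folklore] -/
theorem mem_openers_fifo_padWord_iff
    (hbal : 2 * ((univ : Finset (Fin N)).filter fun p => v p = true).card = N)
    (hband : ∀ j, j ≤ N →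
      ((univ : Finset (Fin N)).filter fun p => p.val < j ∧ v p = false).card
        < ((univ : Finset (Fin N)).filter fun p => p.val < j ∧ v p = true).card + m ∧
      ((univ : Finset (Fin N)).filter fun p => p.val < j ∧ v p = true).card
        < ((univ : Finset (Fin N)).filter fun p => p.val < j ∧ v p = false).card + m)
    (hmL : m ≤ L) (i : Fin (L + N + L)) :
    i ∈ openers (fifo (padWord L N v) (balanced_padWord v hbal)) ↔ padWord L N v i = true :=
  mem_openers_fifo_iff (isBallot_padWord v hbal (fun j hj => (hband j hj).1) hmL) i

/-- ★★ **Transported form** (the matchings of `Fin (2n)`, `2n = L + N + L`, on which the thick-queue measure lives): every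
arc of `i ↦ cast (fifo (U^L v D^L) (cast⁻¹ i))` has length `≥ L − m + 1`. [cite: GrytczukPawlikRucinski2025, Prop. 1] -/
theorem cast_fifo_padWord_arcs_long {n : ℕ} (hM : L + N + L = 2 * n)
    (hbal : 2 * ((univ : Finset (Fin N)).filter fun p => v p = true).card = N)
    (hband : ∀ j, j ≤ N →
      ((univ : Finset (Fin N)).filter fun p => p.val < j ∧ v p = false).card
        < ((univ : Finset (Fin N)).filter fun p => p.val < j ∧ v p = true).card + m ∧
      ((univ : Finset (Fin N)).filter fun p => p.val < j ∧ v p = true).card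
        < ((univ : Finset (Fin N)).filter fun p => p.val < j ∧ v p = false).card + m)
    (hmL : m ≤ L) (hm : 1 ≤ m) :
    ∀ i ∈ openers (fun i : Fin (2 * n) =>
        Fin.cast hM (fifo (padWord L N v) (balanced_padWord v hbal) (Fin.cast hM.symm i))),
      (i : ℕ) + (L - m + 1)
        ≤ (Fin.cast hM (fifo (padWord L N v) (balanced_padWord v hbal) (Fin.cast hM.symm i)) : ℕ) := by
  intro i hi
  rw [mem_openers, Fin.lt_def, Fin.val_cast] at hi
  have hio : padWord L N v (Fin.cast hM.symm i) = true :=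
    (lt_fifo_iff (isBallot_padWord v hbal (fun j hj => (hband j hj).1) hmL) (Fin.cast hM.symm i)).1
      (by rw [Fin.lt_def, Fin.val_cast]; exact hi)
  have h := fifo_padWord_arcs_long v hbal hband hmL hm hio
  rw [Fin.val_cast] at h
  rw [Fin.val_cast]
  exact h

end Pad

end Summit.ValiantsHypothesis.ValiantsHypothesis.Theorems.FifoMatching.NNDivisionHard.PadWordLongArcs

end
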